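import Mathlib
import HarnessLib
import HarnessLib.Audit
import Summits.RiemannHypothesis.Statement
import Summits.RiemannHypothesis.RiemannHypothesis.Theorems.Splittings.ScrewLatticeThinWall
import Summits.RiemannHypothesis.RiemannHypothesis.Theorems.Splittings.ScrewLatticeSupB2
import HarnessLib.Audit.Status.Attr

/-!
Route: ScrewPolar

# Route ScrewPolar — X-18 POLAR SPLIT — X-10 analyticity of the lattice generating function weakened
to ISOLATED singularities in the disc; with a thin wall this forces «sup Re ρ attained», a lattice
floor then gives RH

D-0145 LINE of seat rh-idea-1 (technique: splitting / criterion search; bears_on LADDER-RH rung S-P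
«search for NEW splits (screw §19 ff.)»,
column SCREW §19–20). It suffices to show X = X-18: PolarFlux ∧ IsolFloorOne ∧ DiscreteMaxRe ∧
ThinWallOne ⟹ RH, where the PROVABLE content is
the RH-free crux `PolarFlux`: for every step h > 0, if the lattice generating function G_h(z) = Σ
Ψ(kh) z^k admits an analytic continuation F
to 𝔻 ∖ P for some relatively discrete puncture set P (finitely many punctures in every closed
sub-disc |z| ≤ r < 1) and the closed wall
closure(aliasedPoleSet h) has zero length (TW(h)), then the aliased pole field itself is relatively
discrete — every folded off-line zero is a
puncture. Mechanism: X-10's circles theorem LOCALISED. X-10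
(`ScrewBorelFlux.false_of_small_circles`) needs F holomorphic on the whole disc;
here F is holomorphic off P, and the same three moves go through pointwise at every folded zero p ∉
P: good radii exist for the null set
closure(T_h) ∪ P (P is countable), the identity theorem runs on the preconnected set 𝔻 ∖ (closure
T_h ∪ P) ∋ 0, and Cauchy's theorem runs on
the P-free disc around p; the flux tends to p·C_p ≠ 0 — contradiction, so T_h ⊆ P. A relatively
discrete pole field has a pole of LEAST
modulus e^{−h·max|Re ρ − 1/2|}: the supremum of the real parts of the zeros is ATTAINED (support
`DiscreteMaxRe`, size S — Ingham's hypothesis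
«Θ attained»), and the landed row X-8″ `ScrewLatticeSup.rh_of_maxRe_of_latticeFloor` (MaxRe ∧
lattice floor ⟹ RH, Tannery–Bohr mean) finishes.
The conjunct `IsolFloorOne` = ISOL(1) ∧ FLOOR(1) («G_1 continues to 𝔻 up to isolated punctures —
e.g. it is MEROMORPHIC in 𝔻 — and Ψ(k) ≥ −K»,
RH-implied with P = ∅ and K = 0, Sketch7 `isolFloorOne_of_rh`) and `ThinWallOne` = TW(1) complete
the split RH ⟺ ISOL(1) ∧ FLOOR(1) ∧ TW(1).
Reading: in X-10 analyticity (CEIL) does two jobs — it forbids hidden walls (with TW) and it forbids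
visible poles; the second job is done by a
mere lattice FLOOR, so CEIL may be weakened to «isolated singularities only». Nothing here bears on
the truth of RH.
Lean: `Summit.RiemannHypothesis.RiemannHypothesis.Theses.ScrewPolar.PolarFlux →
Summit.RiemannHypothesis.RiemannHypothesis.Theses.ScrewPolar.IsolFloorOne →
Summit.RiemannHypothesis.RiemannHypothesis.Theses.ScrewPolar.DiscreteMaxRe →
Summit.RiemannHypothesis.RiemannHypothesis.Theses.ScrewPolar.ThinWallOne → Summit.RiemannHypothesis`

## Assembly
Pure logic over the landed row X-8″, kernel-checked in the seat folder (Sketch7.lean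
`assembly_holds`, 4 lines, rc 0): PolarFlux at h = 1 with
ISOL(1) and TW(1) gives the discrete pole field; DiscreteMaxRe gives MaxRe;
`ScrewLatticeSup.rh_of_maxRe_of_latticeFloor one_pos` with FLOOR(1)
gives RH. The deciding theorem is `closes (h₁ : PolarFlux) (h₂ : IsolFloorOne) (h₃ : DiscreteMaxRe)
(h₄ : ThinWallOne) (hA : Assembly) :=
hA h₁ h₂ h₃ h₄`; the Assembly item is PROVABLE NOW (proof text attached as evidence at birth).

Rationale: WHY THIS LINE. Mechanism: every landed or filed screw row asks the Ψ-side for a GROWTH statement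
(CEIL, floors, sign regularity) whose function-theoretic
content is «G_h is ANALYTIC along the relevant part of 𝔻». This line asks for the weaker singularity
TYPE statement «the singularities of G_h
that can be reached in 𝔻 are isolated» (ISOL; in particular «G_h is meromorphic in 𝔻», the object of
Hadamard's theory of polar
singularities — decidable in principle from the samples Ψ(kh) through Hankel determinants / the
qd-algorithm,
[corpus:book:cuyt1987-nonlinear-methods-numerical-analysis p114], [corpus:paper:arxiv-1606.08960
p17]) and shows that visible POLES cost
nothing beyond a lattice floor: a reachable pole of least modulus puts a finite-modulus top layer of
class charges with negative real parts into
the samples, which the Bohr mean of X-8″ (landed `ScrewLatticeSup.rh_of_maxRe_of_latticeFloor`,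
`maxRe_and_latticeFloor_iff_rh`) cannot
reconcile with Ψ(kh) ≥ −K. What it does that listed routes do not: X-10 (CEIL ∧ TW) and X-8″ (MaxRe
∧ LAT) are glued through a NEW RH-free
theorem — thin wall + isolated reachable singularities ⟹ discrete pole field ⟹ Θ attained — so the
zero-side hypothesis of Ingham's
Ω-theorem («there is a zero with real part Θ») receives a coefficient-side sufficient condition, and
X-10's CEIL is replaced by ISOL at the
price of a floor. Imported from complex analysis: flux/argument through walls of zero length
(Painlevé-type null sets; [galaxy:panama:466132800634964]
Zalcman, Analytic capacity; [corpus:book:ross2002-generalized-analytic-continuation p33]) exactly as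
in the tree's `ScrewBorelFluxA/B`, now
localised; from the tree: `differentiableOn_borel`, `latticeGF_eq_borel`,
`aliasedPoleSet_nonempty_of_not_rh`, `exists_zero_on_critical_line`,
X-8″. BC5 rung = the P = ∅ corner of PolarFlux, landed:
`ScrewLatticeThinWall.aliasedPoleSet_eq_empty_of_latticeCeiling_of_thinWall`.

RANKED CRUXES. #2 PolarFlux (crux) — RH-free theorem about ζ (the provable content). For every h >
0: if there are a set P with P ∩ closedBall(0,r) finite for every r < 1 and a function F
differentiable on ball(0,1) ∖ P with F = latticeGF h on a neighbourhood of 0, and ThinWall h holds,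
then aliasedPoleSet h ∩ closedBall(0,r) is finite for every r < 1. [difficulty: M] (why it might
fail: Lean cost: re-plumbing ScrewBorelFluxA/B from `DifferentiableOn F (ball 0 1)` to `ball 0 1 \
P` (good radii for closure T_h ∪ P, preconnectedness of the doubly-punctured complement, Cauchy on
P-free discs). No mathematical gap known.) [Suzuki2023,
corpus:book:ross2002-generalized-analytic-continuation p33, galaxy:panama:466132800634964]
#3 IsolFloorOne (crux) — The conjunct at step 1 (RH-implied, the searchable object): ISOL(1) — there
are a relatively discrete puncture set P ⊆ ℂ (finitely many points in each closed disc of radius <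
1) and F holomorphic on 𝔻 ∖ P agreeing with the lattice generating function Σ Ψ(k) z^k near 0 (e.g.
the generating function is MEROMORPHIC in 𝔻) — AND FLOOR(1): Ψ(k) ≥ −K for all k ∈ ℕ and some K.
Under RH: P = ∅, K = 0 (Sketch7 `isolFloorOne_of_rh`). [difficulty: open-problem] (why it might
fail: False iff ¬RH and either G_1 meets a non-isolated reachable singularity (generic: a visible
circle arc of folded zeros) or Ψ(k) is unbounded below on ℕ; blind models B16/B16′ satisfy it (P =
∅), so TW(1) is what excludes them.) [Suzuki2023,
corpus:book:cuyt1987-nonlinear-methods-numerical-analysis p114, corpus:paper:arxiv-1606.08960 p17]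
#9 DiscreteMaxRe (support) — Size S, RH-free: for every h > 0, if aliasedPoleSet h ∩ closedBall(0,r)
is finite for every r < 1 then the supremum of the real parts of the non-trivial zeros is attained
(∃ ρ₀ ∈ 𝒩 ∀ ρ ∈ 𝒩, Re ρ ≤ Re ρ₀). Proof: folded zeros have modulus e^{−h|Re ρ − 1/2|} ≥ e^{−h/2};
finitely many moduli below each r < 1 ⟹ the least modulus is attained ⟹ max |Re ρ − 1/2| attained
(reflect by ρ ↦ 1 − conj ρ, `one_sub_conj_mem`); empty field ⟹ RH
(`aliasedPoleSet_nonempty_of_not_rh`) ⟹ Hardy's zero (`ScrewLatticeSup.maxRe_of_rh`). [difficulty: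
S] [Suzuki2023, Ingham1932]
#9 ThinWallOne (support) — TW(1): the closed wall has zero length in 𝔻 (row X-10's hypothesis;
RH-implied, `thinWall_of_rh`). Same text as ScrewFabry.ThinWallOne / ScrewMultisection.ThinWallOne
(shared item expected). [difficulty: open-problem] [Suzuki2023,
corpus:book:ross2002-generalized-analytic-continuation p33]

TWO-LAYER PLAN. PolarFlux ⇐ (G1) good circles: TW(h) and P relatively discrete ⟹ around every folded
zero p ∉ P there are arbitrarily small circles inside a
preconnected V ∋ 0 with V ⊆ (𝔻 ∖ closure T_h) ∖ P (M⁻; `ScrewBorelFluxB` §5 good radii for the null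
set closure T_h ∪ P) → (G2) the localised
circles theorem: F holomorphic on 𝔻 ∖ P, = G_h near 0, such circles around an inside pole p ∉ P ⟹
False (M, hardest; `false_of_small_circles`
with Cauchy on the P-free disc around p). Skeleton with both stubs and the proved composition
`PolarFlux_of` in the seat folder
(bc/Polar_birth_pre.lean, rc 0, sorries = 2 = stubs). DiscreteMaxRe is one S file (least modulus of
a relatively discrete set + reflection).

KILL CRITERIA. A refutation of PolarFlux (claimed RH-free theorem) closes the route
`refuted:PolarFlux` and would expose an error in the localisation of the
flux argument. A cheap kernel proof of IsolFloorOne ⟹ RH would make the row a costume (not expected: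
B16/B16′ satisfy ISOL ∧ FLOOR). Critic
grade «variant of X-10/X-8″» with a STRIKE retires the line to a remark under X-10 («CEIL may be
weakened to ISOL given a floor»).

NOT DECOMPOSED YET. (G1)–(G2) are layer-2 children for the prover. The Hadamard/Hankel reading of
ISOL (meromorphy from the samples) is the instrument row, not an
item. The stronger bridge «ISOL(h) ∧ TW(h) ⟹ RH ∨ MaxRe» is PolarFlux + DiscreteMaxRe and is not
filed separately.

CHEAPEST FALSIFIER. (i) Costume/tautology: `#h21_crux_probe … summit := Summit.RiemannHypothesis` on
PolarFlux / IsolFloorOne / DiscreteMaxRe / ThinWallOne /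
Assembly — 5/5 CLEAN before filing (bc/probe7.out; Assembly informational only); BC2 `C → RH` probes
fail 4/4 and BC4 `exact?` fails on the
new items (bc/probe7_bc2.lean); converse RH → IsolFloorOne closes (consequence of RH used toward RH
— fine). (ii) By hand: a single off-line
zero quadruple gives a finite wall — ISOL ✓, TW ✓, ¬RH — so the floor conjunct is necessary; B16′
(Wolff data, CEIL ∧ LAT) gives ISOL with
P = ∅ and FLOOR — so TW is necessary; a relatively discrete field has an attained least modulus, and
the top layer is a finite set of classes
with Re C_p < 0 (absolute convergence of `coeff`), which is exactly X-8″'s hypothesis. (iii)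
Instrument row: Hankel determinants
H_k^{(m)}(Ψ(·h)) of the samples — Hadamard: G_h has exactly m poles in |z| < r iff limsup
|H_k^{(m)}|^{1/k} = (r_1⋯r_m)^{−1} pattern; any
certified negative Ψ(k) < −K growth already refutes FLOOR (and RH, Suzuki Thm 1.7).

NUMBERS. Folded zeros have modulus in [e^{−h/2}, 1); at h = 1 the germ disc ‖z‖ < e^{−1/2} ≈ 0.6065
is wall-free, so «F = G_1 near 0» may be checked
on any ε ≤ e^{−1/2}. No hand-picked thresholds (checklist 4c(iv)): P, F, ε, K are existential in the
conjunct and universal in the bridge.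

DEFINITION REQUESTS. None (ISOL is inlined as an ∃ P F ε clause over Mathlib's `DifferentiableOn`;
no `MeromorphicOn` API is needed).

Novelty: Searches (2026-08-27): lit search --hybrid "Hadamard theorem meromorphic continuation power series
Hankel determinants polar singularities" (6 docs, automorphic/complex-analysis textbooks, no
zeta-lattice use); lit search '"Hankel determinants" meromorphic poles' --source local
([corpus:paper:arxiv-1606.08960 p17] qd-algorithm finds poles of meromorphic functions;
[corpus:book:cuyt1987-nonlinear-methods-numerical-analysis p114]); lit search --hybrid "analytic
continuation across a closed set of linear measure zero Painleve removable singularities"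
([corpus:book:conway1978-functions-one-complex-variable-i p133], Chirka); lit galaxy search "Hankel
determinant|polar singularities|Painlevé null" --star panama --title-contains analytic
([galaxy:panama:466132800634964] Zalcman, Analytic Capacity and Rational Approximation); desk census
KEYS-RH-LINES-D0145 / rh-split HANDOFF §17–§21 (rows X-8, X-8′, X-8″, X-9, X-10: none with a
meromorphy / isolated-singularity conjunct); rg 'Meromorphic|isolated singular' over
lean/Summits/RiemannHypothesis (no Splittings hit).
Nearest prior art found: X-10 `ScrewLatticeThinWall.rh_of_latticeCeiling_of_thinWall` (CEIL ∧ TW)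
and X-8″ `ScrewLatticeSup.maxRe_and_latticeFloor_iff_rh` (MaxRe ∧ floor), both landed today by the
rh-split cell; this seat's X-11–X-17.
Delta: first split whose Ψ-side function-theoretic clause is a SINGULARITY-TYPE statement (isolated
/ polar singularities, Hadamard–Hankel instrument) rather than analyticity or growth, glued t  [refs: paper:arxiv-1606.08960, book:cuyt1987-nonlinear-methods-numerical-analysis, book:conway1978-functions-one-complex-variable-i]

Barriers (technique_class: splitting, criterion-search, borel-continuation): - technique_class: splitting, criterion-search, borel-continuation
- Literature.Barriers.RiemannHypothesis.DavenportHeilbronn: outside — no zero-free region or Euler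
product; the bridge runs through ζ's explicit-formula dictionary (`latticeGF_eq_borel`, Suzuki2023)
and plane measure theory.
- Literature.Barriers.RiemannHypothesis.BrouckeDebruyneRevesz2023_thm13: outside (Beurling
counterexamples) — no Beurling-prime input; one fixed ℓ¹ Borel family.
- Literature.Barriers.RiemannHypothesis.ExceptionalZero: outside — no Dirichlet character, no
zero-free region.
- Literature.Barriers.RiemannHypothesis.BohrDenseValues: outside — no value distribution; the
relevant invisibility results are the tree blind models B14/B16/B16′, honoured: B16/B16′ satisfy
ISOL (P = ∅) and FLOOR and have walls of positive length, so TW is what excludes them; a finite wall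
satisfies ISOL ∧ TW and violates FLOOR (X-8″).
- Negatives index: none of stmt-RiemannHypothesis-15969/15970/16980/2575 or the screw-neg landed
negatives (SIZE floors at specific k) is a singularity-type or bounded-floor statement; nothing
refuted is re-wanted.

sub-problem: RiemannHypothesis · status: open · opened planner-rh-idea-1-g0-0 2026-08-27T23:21:19Z · rev 0 · ledger route-RiemannHypothesis-ScrewPolar
GENERATED by the gate from the ledger (D-0016/17). Provers cite these decls: `theorem foo : Summit.RiemannHypothesis.RiemannHypothesis.Theses.ScrewPolar.<Decl> := …` in Summits/RiemannHypothesis/RiemannHypothesis/Theorems/<Name>.lean.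
-/

namespace Summit.RiemannHypothesis.RiemannHypothesis.Theses.ScrewPolar

open scoped BigOperators Topology Manifold Classical MeasureTheory ProbabilityTheory Matrix InnerProductSpace ComplexConjugate ContinuousMap
open Filter Set Function TopologicalSpace MeasureTheory

attribute [summit_statement] _root_.Summit.RiemannHypothesis

open Summit

/-- item stmt-RiemannHypothesis-23570 · crux · rank 2 · open · by planner
why it might fail: Lean cost: re-plumbing ScrewBorelFluxA/B from `DifferentiableOn F (ball 0 1)` to `ball 0 1 \ P` (good radii for closure T_h ∪ P, preconnectedness of the doubly-punctured complement, Cauchy on P-free discs). No mathematical gap known.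
sources: Suzuki2023, corpus:book:ross2002-generalized-analytic-continuation p33, galaxy:panama:466132800634964
[crux] RH-free theorem about ζ (the provable content). For every h > 0: if there are a set P with P
∩ closedBall(0,r) finite for every r < 1 and a function F differentiable on ball(0,1) ∖ P with F =
latticeGF h on a neighbourhood of 0, and ThinWall h holds, then aliasedPoleSet h ∩ closedBall(0,r)
is finite for every r < 1. [difficulty: M] -/
@[route_item "route-RiemannHypothesis-ScrewPolar", crux]
def PolarFlux : Prop :=
  ∀ h : ℝ, 0 < h → (∃ P : Set ℂ, (∀ r : ℝ, r < 1 → (P ∩ Metric.closedBall (0 : ℂ) r).Finite) ∧ ∃ F : ℂ → ℂ, DifferentiableOn ℂ F (Metric.ball 0 1 \ P) ∧ ∃ ε : ℝ, 0 < ε ∧ ∀ z : ℂ, ‖z‖ < ε → F z = Theorems.Splittings.ScrewLatticeContinuation.latticeGF h z) → Theorems.Splittings.ScrewLatticeThinWall.ThinWall h → ∀ r : ℝ, r < 1 → (Theorems.Splittings.ScrewLatticeContinuation.aliasedPoleSet h ∩ Metric.closedBall (0 : ℂ) r).Finite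

/-- item stmt-RiemannHypothesis-23571 · crux · rank 3 · open · by planner
why it might fail: False iff ¬RH and either G_1 meets a non-isolated reachable singularity (generic: a visible circle arc of folded zeros) or Ψ(k) is unbounded below on ℕ; blind models B16/B16′ satisfy it (P = ∅), so TW(1) is what excludes them.
sources: Suzuki2023, corpus:book:cuyt1987-nonlinear-methods-numerical-analysis p114, corpus:paper:arxiv-1606.08960 p17
[crux] The conjunct at step 1 (RH-implied, the searchable object): ISOL(1) — there are a relatively
discrete puncture set P ⊆ ℂ (finitely many points in each closed disc of radius < 1) and F
holomorphic on 𝔻 ∖ P agreeing with the lattice generating function Σ Ψ(k) z^k near 0 (e.g. the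
generating function is MEROMORPHIC in 𝔻) — AND FLOOR(1): Ψ(k) ≥ −K for all k ∈ ℕ and some K. Under
RH: P = ∅, K = 0 (Sketch7 `isolFloorOne_of_rh`). [difficulty: open-problem] -/
@[route_item "route-RiemannHypothesis-ScrewPolar", crux]
def IsolFloorOne : Prop :=
  (∃ P : Set ℂ, (∀ r : ℝ, r < 1 → (P ∩ Metric.closedBall (0 : ℂ) r).Finite) ∧ ∃ F : ℂ → ℂ, DifferentiableOn ℂ F (Metric.ball 0 1 \ P) ∧ ∃ ε : ℝ, 0 < ε ∧ ∀ z : ℂ, ‖z‖ < ε → F z = Theorems.Splittings.ScrewLatticeContinuation.latticeGF 1 z) ∧ ∃ K : ℝ, ∀ k : ℕ, -K ≤ Literature.NumberTheory.LFunctions.zetaScrew (k * (1 : ℝ))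

/-- item stmt-RiemannHypothesis-23059 · support · rank 9 · open · by planner
sources: Suzuki2023, corpus:book:ross2002-generalized-analytic-continuation p33
[support] TW(1): the closed wall has zero length in 𝔻 (row X-10's hypothesis; RH-implied,
`thinWall_of_rh`). [difficulty: open-problem] -/
@[route_item "route-RiemannHypothesis-ScrewPolar", crux]
def ThinWallOne : Prop :=
  Theorems.Splittings.ScrewLatticeThinWall.ThinWall 1

/-- item stmt-RiemannHypothesis-23572 · support · rank 9 · open · by planner
sources: Suzuki2023, Ingham1932
[support] Size S, RH-free: for every h > 0, if aliasedPoleSet h ∩ closedBall(0,r) is finite for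
every r < 1 then the supremum of the real parts of the non-trivial zeros is attained (∃ ρ₀ ∈ 𝒩 ∀ ρ ∈
𝒩, Re ρ ≤ Re ρ₀). Proof: folded zeros have modulus e^{−h|Re ρ − 1/2|} ≥ e^{−h/2}; finitely many
moduli below each r < 1 ⟹ the least modulus is attained ⟹ max |Re ρ − 1/2| attained (reflect by ρ ↦
1 − conj ρ, `one_sub_conj_mem`); empty field ⟹ RH (`aliasedPoleSet_nonempty_of_not_rh`) ⟹ Hardy's
zero (`ScrewLatticeSup.maxRe_of_rh`). [difficulty: S] -/
@[route_item "route-RiemannHypothesis-ScrewPolar", crux]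
def DiscreteMaxRe : Prop :=
  ∀ h : ℝ, 0 < h → (∀ r : ℝ, r < 1 → (Theorems.Splittings.ScrewLatticeContinuation.aliasedPoleSet h ∩ Metric.closedBall (0 : ℂ) r).Finite) → ∃ ρ₀ : ℂ, ρ₀ ∈ Literature.NumberTheory.LFunctions.ZetaZeros.riemannZetaNontrivialZeros ∧ ∀ ρ : ℂ, ρ ∈ Literature.NumberTheory.LFunctions.ZetaZeros.riemannZetaNontrivialZeros → ρ.re ≤ ρ₀.re

/-- item stmt-RiemannHypothesis-23573 · assembly · rank 1 · open · by planner
sources: Suzuki2023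
[assembly] PolarFlux → IsolFloorOne → DiscreteMaxRe → ThinWallOne → RH (provable now; proof =
Sketch7.lean `assembly_holds`). -/
@[route_item "route-RiemannHypothesis-ScrewPolar", crux]
def Assembly : Prop :=
  PolarFlux → IsolFloorOne → DiscreteMaxRe → ThinWallOne → Summit.RiemannHypothesis

/-! D-0027 §2.1 — DECIDING THEOREM (planner-authored via `route open/edit --closes-file`; by planner-rh-idea-1-g0-0 2026-08-27T23:21:19Z):
its hypotheses are this route's items and its conclusion the sub-problem Statement (glue_lint), and it elaborates with this file. -/

@[closes "route-RiemannHypothesis-ScrewPolar"] theorem closes (h₁ : PolarFlux) (h₂ : IsolFloorOne) (h₃ : DiscreteMaxRe) (h₄ : ThinWallOne)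
    (hA : Assembly) : Summit.RiemannHypothesis := hA h₁ h₂ h₃ h₄

end Summit.RiemannHypothesis.RiemannHypothesis.Theses.ScrewPolar
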